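import Literature.NumberTheory.Automorphic.JacquetRankStrictMono            -- ★ `Representation.not_bot_lt_lt_lt_top_of_finrank_coinvariants_le_two`
import Literature.NumberTheory.Automorphic.ConstituentsOfExtension          -- ★ `isConstituentOf_iff_of_isIrreducible`, `isIrreducible_…_of_forall_not_lt_lt`
import Literature.NumberTheory.Automorphic.SmoothCharacterOfCharacter       -- ★ `SmoothIrrep.ofChar`
import HarnessLib

/-!
# A smooth representation of Jacquet rank `≤ 2` with a one-dimensional quotient `ℂ_ξ` has exactly two constituents `{ℂ_ξ, π}`
# ([Casselman1995, §7.1] bookkeeping; [Rogawski1990, §12.1 case (1)] shape)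

Generic representation theory (theorems only; no definition, no named fact, no instance, no `sorry`).  Topic `NumberTheory/Automorphic`,
namespace `Literature.NumberTheory.Automorphic.IrrClass`.  Cell `pub/hodgecm-mathlib`, line «CMCharIdentityTest» (F0P3b), road (N-H-ii) ⟸ (JH₂):
the ONE-CALL assembly the `U(Φ₂)(L⁺_v)` closer of (JH₂) feeds with (a) the Jacquet-rank bound `finrank r_P(ρ) ≤ 2` (★
`F0P3bU2PrincipalSeriesJacquetRankLeTwo` at `N = 2`), (b) «every irreducible constituent of `ρ` has `r_P ≠ 0`» (Harish-Chandra ∕ Casselman for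
the group at hand), (c) a NON-ZERO `(G, ξ)`-equivariant linear functional `q` (`q (ρ g v) = ξ g · q v`: the one-dimensional QUOTIENT `ℂ_ξ`) and (d) «`ρ` has no
non-zero `ξ`-eigenvector» (`ℂ_ξ` is not a SUBrepresentation).  OUTPUT **`exists_constituents_pair_of_quotient_char`**: a class `π ≠ ⟦ℂ_ξ⟧` with
`JH(ρ) = {⟦ℂ_ξ⟧, π}` EXACTLY, and `ρ` has no chain `⊥ < N₁ < N₂ < ⊤` — `π = ⟦ker q⟧`.
Proof: no 3-chain by ★ `Representation.not_bot_lt_lt_lt_top_of_finrank_coinvariants_le_two` ((a) + (b) + exactness of `r_P`, `N_P` a union of compact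
open subgroups); `K := ker q` is `≠ ⊤` (`q ≠ 0`) and `≠ ⊥` (else `q` is injective and every vector is a `ξ`-eigenvector, so `ρ = 0`, contradicting `q ≠ 0`);
hence `ρ|_K`, `ρ ⁄ K` are irreducible (★ `isIrreducible_toRepresentation/quotientRep_of_forall_not_lt_lt`) and `JH(ρ) = {⟦ρ ⁄ K⟧, ⟦ρ|_K⟧}` (★
`isConstituentOf_iff_of_isIrreducible`); `ρ ⁄ K ≅ ℂ_ξ` through `q̄` (`q̄` is injective with non-zero range in the line `ℂ`); and `⟦ρ|_K⟧ ≠ ⟦ℂ_ξ⟧` since an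
equivalence `ρ|_K ≅ ℂ_ξ` would exhibit a non-zero `ξ`-eigenvector.
HONEST LABEL: HC_CM is proved only modulo the printed citations (2 remaining named inputs hLiu418, h413) until rung 0 closes; this file is generic and pays
nothing by itself.

## References
* [Casselman1995] W. Casselman, *Introduction to the theory of admissible representations of p-adic reductive groups* (1995), §7.1 (L. 7.1.1, Cor. 7.1.2,
  Prop. 7.1.3), Prop. 3.2.3.
* [Rogawski1990] J. D. Rogawski, *Automorphic Representations of Unitary Groups in Three Variables* (1990), §12.1 case (1) pp. 171–172
  («`ξ ∈ JH(i_H(χ))`; the remaining constituent is … `St_H(ξ)`»).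
* [BushnellHenniart2006] C. J. Bushnell, G. Henniart, *The Local Langlands Conjecture for GL(2)* (2006), §2 (constituents of extensions).
-/

set_option autoImplicit false

noncomputable section

namespace Literature.NumberTheory.Automorphic

namespace IrrClass

section Algebra

variable {G : Type} [Group G]

/-- **A `(G, ξ)`-equivariant functional `q` (`q (ρ g v) = ξ g · q v`) which is injective forces every vector to be a `ξ`-eigenvector**
(`q (ρ g v) = q (ξ g • v)`). [cite: BushnellHenniart2006, §2] -/
theorem forall_apply_eq_smul_of_ker_eq_bot {V : Type} [AddCommGroup V] [Module ℂ V] {ρ : Representation ℂ G V}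
    (ξ : G →* ℂˣ) (q : V →ₗ[ℂ] ℂ) (hq : ∀ (g : G) (v : V), q (ρ g v) = ((ξ g : ℂˣ) : ℂ) * q v)
    (hK : LinearMap.ker q = ⊥) (v : V) (g : G) : ρ g v = ((ξ g : ℂˣ) : ℂ) • v := by
  have h2 : q (ρ g v - ((ξ g : ℂˣ) : ℂ) • v) = 0 := by rw [map_sub, map_smul, hq, smul_eq_mul, sub_self]
  exact sub_eq_zero.1 ((LinearMap.ker_eq_bot.1 hK) (by rw [h2, map_zero]))

end Algebra

section Character

variable {G : Type} [Group G] [TopologicalSpace G] [IsTopologicalGroup G]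

/-- **`ρ ⁄ ker q ≅ ℂ_ξ`** for a NON-ZERO `(G, ξ)`-equivariant functional `q` and any subrepresentation `K` whose underlying subspace is `ker q`
(`q̄` is injective and its range is a non-zero subspace of the line `ℂ`). [cite: BushnellHenniart2006, §2] -/
theorem nonempty_quotientRep_equiv_ofChar_of_eq_ker {V : Type} [AddCommGroup V] [Module ℂ V] {ρ : Representation ℂ G V}
    (ξ : G →* ℂˣ) (hξ : IsOpen ((ξ.ker : Subgroup G) : Set G)) (q : V →ₗ[ℂ] ℂ) (hq : ∀ (g : G) (v : V), q (ρ g v) = ((ξ g : ℂˣ) : ℂ) * q v)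
    (hq0 : ∃ v, q v ≠ 0) (K : Subrepresentation ρ) (hK : K.toSubmodule = LinearMap.ker q) :
    Nonempty (K.quotientRep.Equiv (SmoothIrrep.ofChar ξ hξ).ρ) := by
  obtain ⟨v₀, hv₀⟩ := hq0
  -- the range of `q` is all of `ℂ`
  have hrange : LinearMap.range q = ⊤ := by
    refine eq_top_iff.2 fun z _ => ⟨(z / q v₀) • v₀, ?_⟩
    rw [map_smul, smul_eq_mul, div_mul_cancel₀ z hv₀]
  -- `q̄ : V ⧸ K ≃ₗ ℂ`
  let e : (V ⧸ K.toSubmodule) ≃ₗ[ℂ] ℂ :=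
    (Submodule.quotEquivOfEq _ _ hK).trans (q.quotKerEquivRange.trans (LinearEquiv.ofTop _ hrange))
  have he : ∀ v : V, e (Submodule.Quotient.mk v) = q v := fun v => rfl
  refine ⟨Representation.Equiv.mk e fun g => Submodule.linearMap_qext _ (LinearMap.ext fun v => ?_)⟩
  change e (K.quotientRep g (Submodule.Quotient.mk v)) = (SmoothIrrep.ofChar ξ hξ).ρ g (e (Submodule.Quotient.mk v))
  rw [Subrepresentation.quotientRep_mk, he, he, SmoothIrrep.ofChar_ρ_apply, hq]

/-- **An equivalence `ρ|_K ≅ ℂ_ξ` exhibits a non-zero `ξ`-eigenvector of `ρ`** (the image of `1`). [cite: BushnellHenniart2006, §2] -/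
theorem exists_ne_zero_apply_eq_smul_of_equiv_ofChar {V : Type} [AddCommGroup V] [Module ℂ V] {ρ : Representation ℂ G V}
    (ξ : G →* ℂˣ) (hξ : IsOpen ((ξ.ker : Subgroup G) : Set G)) (K : Subrepresentation ρ)
    (e : K.toRepresentation.Equiv (SmoothIrrep.ofChar ξ hξ).ρ) :
    ∃ v : V, v ≠ 0 ∧ ∀ g : G, ρ g v = ((ξ g : ℂˣ) : ℂ) • v := by
  let e' : ↥K.toSubmodule ≃ₗ[ℂ] ℂ := e.toLinearEquiv
  have he' : ∀ (g : G) (x : ↥K.toSubmodule), e' (K.toRepresentation g x) = ((ξ g : ℂˣ) : ℂ) * e' x := fun g x => by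
    have h := Representation.IntertwiningMap.isIntertwining _ _ e.toIntertwiningMap g x
    rw [SmoothIrrep.ofChar_ρ_apply] at h
    exact h
  let w : ↥K.toSubmodule := e'.symm (1 : ℂ)
  have hw1 : e' w = (1 : ℂ) := e'.apply_symm_apply 1
  refine ⟨(w : V), fun h0 => ?_, fun g => ?_⟩
  · have hw0 : w = 0 := Subtype.ext h0
    have : e' w = (0 : ℂ) := by rw [hw0, map_zero]
    rw [hw1] at this
    exact one_ne_zero this
  · have hg : e' (K.toRepresentation g w) = e' (((ξ g : ℂˣ) : ℂ) • w) := by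
      rw [map_smul, he', smul_eq_mul]
    have hg' : K.toRepresentation g w = ((ξ g : ℂˣ) : ℂ) • w := e'.injective hg
    have := congrArg (fun x : ↥K.toSubmodule => (x : V)) hg'
    rw [Submodule.coe_smul] at this
    exact this

end Character

section Pair

variable {G : Type} [Group G] [TopologicalSpace G] [IsTopologicalGroup G] (t : ParabolicTriple G)

/-- **THE PAIR OF CONSTITUENTS OF A JACQUET-RANK-`≤ 2` REPRESENTATION WITH A CHARACTER QUOTIENT** (see the module docstring): for a parabolic
triple `t = (P, M, N)` of `G` with `N` a union of compact open subgroups, a smooth `ρ` on `V : Type` with `finrank r_P(ρ) ≤ 2` all of whose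
irreducible constituents have `r_P ≠ 0`, a smooth character `ξ` with a NON-ZERO `(G, ξ)`-equivariant functional `q` (`q (ρ g v) = ξ g · q v`), and
no non-zero `ξ`-eigenvector in `ρ`: there is `π ≠ ⟦ℂ_ξ⟧` with `JH(ρ) = {⟦ℂ_ξ⟧, π}` exactly, and `ρ` has no chain `⊥ < N₁ < N₂ < ⊤` (`π = ⟦ρ|_{ker q}⟧`).
[cite: Casselman1995, §7.1 Cor. 7.1.2, Prop. 7.1.3] [cite: Rogawski1990, §12.1 case (1) pp. 171–172] [cite: BushnellHenniart2006, §2] -/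
theorem exists_constituents_pair_of_quotient_char (hN : IsLimitOfCompactOpen ↥t.N)
    {V : Type} [AddCommGroup V] [Module ℂ V] (ρ : Representation ℂ G V) (hρ : ρ.IsSmooth)
    (h : ∀ c : IrrClass G, c.IsConstituentOf ρ → ∃ r : SmoothIrrep G, IrrClass.mk r = c ∧ Nontrivial (t.restrict r.ρ).Coinvariants)
    [FiniteDimensional ℂ (t.restrict ρ).Coinvariants] (h2 : Module.finrank ℂ (t.restrict ρ).Coinvariants ≤ 2)
    (ξ : G →* ℂˣ) (hξ : IsOpen ((ξ.ker : Subgroup G) : Set G)) (q : V →ₗ[ℂ] ℂ)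
    (hq : ∀ (g : G) (v : V), q (ρ g v) = ((ξ g : ℂˣ) : ℂ) * q v) (hq0 : ∃ v, q v ≠ 0)
    (heig : ∀ v : V, (∀ g : G, ρ g v = ((ξ g : ℂˣ) : ℂ) • v) → v = 0) :
    ∃ π : IrrClass G, π ≠ IrrClass.mk (SmoothIrrep.ofChar ξ hξ) ∧
      (∀ c : IrrClass G, c.IsConstituentOf ρ ↔ (c = IrrClass.mk (SmoothIrrep.ofChar ξ hξ) ∨ c = π)) ∧
      ∀ N₁ N₂ : Subrepresentation ρ, ¬ (⊥ < N₁ ∧ N₁ < N₂ ∧ N₂ < ⊤) := by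
  -- length ≤ 2
  have hlen : ∀ N₁ N₂ : Subrepresentation ρ, ¬ (⊥ < N₁ ∧ N₁ < N₂ ∧ N₂ < ⊤) :=
    Representation.not_bot_lt_lt_lt_top_of_finrank_coinvariants_le_two t hN hρ h h2
  -- `K = ker q` as a subrepresentation (`q (ρ g v) = ξ g · q v`)
  obtain ⟨K, hK⟩ : ∃ K : Subrepresentation ρ, K.toSubmodule = LinearMap.ker q :=
    ⟨⟨LinearMap.ker q, fun g v hv => by
      rw [LinearMap.mem_ker] at hv ⊢
      rw [hq, hv, mul_zero]⟩, rfl⟩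
  have hKq : ∀ v : V, v ∈ K ↔ q v = 0 := fun v => by
    rw [← LinearMap.mem_ker, ← hK]; rfl
  -- `K` is proper and non-zero
  have hKtop : K ≠ ⊤ := by
    intro hKt
    obtain ⟨v, hv⟩ := hq0
    have hmem : v ∈ K := by rw [hKt]; trivial
    exact hv ((hKq v).1 hmem)
  have hKbot : K ≠ ⊥ := by
    intro hKb
    obtain ⟨v, hv⟩ := hq0
    have hker : LinearMap.ker q = ⊥ := by rw [← hK, hKb]; rfl
    have hv0 : v = 0 := heig v fun g => forall_apply_eq_smul_of_ker_eq_bot ξ q hq hker v g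
    exact hv (by rw [hv0, map_zero])
  have hKirr := isIrreducible_toRepresentation_of_forall_not_lt_lt hlen hKbot hKtop
  have hQirr := isIrreducible_quotientRep_of_forall_not_lt_lt hlen hKbot hKtop
  -- `ρ ⁄ K ≅ ℂ_ξ`
  obtain ⟨e⟩ := nonempty_quotientRep_equiv_ofChar_of_eq_ker ξ hξ q hq hq0 K hK
  have hVK : IrrClass.mk (SmoothIrrep.mk (V ⧸ K.toSubmodule) K.quotientRep hQirr (hρ.quotientRep K)) =
      IrrClass.mk (SmoothIrrep.ofChar ξ hξ) := IrrClass.mk_eq_mk_of_equiv e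
  refine ⟨IrrClass.mk (SmoothIrrep.mk ↥K.toSubmodule K.toRepresentation hKirr (hρ.toRepresentation K)), fun heq => ?_, fun c => ?_, hlen⟩
  · -- `⟦ρ|_K⟧ = ⟦ℂ_ξ⟧` would give a non-zero `ξ`-eigenvector
    obtain ⟨e'⟩ := (IrrClass.mk_eq_mk_iff _ _).1 heq
    obtain ⟨v, hv0, hv⟩ := exists_ne_zero_apply_eq_smul_of_equiv_ofChar ξ hξ K e'
    exact hv0 (heig v hv)
  · rw [isConstituentOf_iff_of_isIrreducible hρ K hKirr hQirr c, hVK]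

end Pair

end IrrClass

end Literature.NumberTheory.Automorphic

end
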